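import Summits.HodgeConjecture.CorCM.Census.OddSliceFacesSquares

/-!
# Faces generate the Hodge lattice of the faithful full odd slice, I: the canonical type squares (one per simple factor of defect
# class `≥ 2`), clearing by defect class, the descent to weight `≤ 1`, and the key lemma on `E ∪ B₁`

COR-CM (cell `pub-hodgecm2`), count-neutral kernel census by the binder seat b09 (gen 26; lane ODD-SLICE-FACES, part III of
`OddSliceFacesModel` → `OddSliceFacesSquares` → `OddSliceFacesDescent` → `OddSliceFacesGenerate` → `OddSliceFacesCount` → `OddSliceFacesRecord`; the statements
and proofs are those of gen 25's `Census/CyclicPrimeFacesDescent.lean` with `ℤ/p` replaced by a finite abelian group `A` of odd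
order).  Bookkeeping definitions + theorems; no `decide` table, no certificate, no named fact, no geometry, no `sorry`.  HC_CM is not
proved anywhere in this cell; nothing here is a headline and nothing here produces a period.

CONTENT (model of parts I–II; `|A|` odd).  §1 THE CANONICAL SQUARES: for each simple factor `ω` (b17's `OddDegreeParityLaw.OrbitsA A`)
of defect class `cls ω ≥ 2` the face `sqFace ω = (rep ω; i, j)` through two defects `i ≠ j` of its normalised representative
(`squares` — one face per simple factor of class `≥ 2`); `spanFaces S` = the span of all Galois translates of the classes of the
faces in `S` (`≤ H` when places are distinct); **`exists_square_through`**: every normalised type of weight `K ≥ 2` is the main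
corner of a translated canonical square.  §2 CLEARING (`clear_step`): a vector supported in weight `≤ K` (`2 ≤ K ≤ |A|/2`) is,
modulo pairs and translates of canonical squares, a vector supported in weight `≤ K − 1` — subtract `m(ψ)·(translated square with
main corner ψ)` for every `ψ` of weight `K` (its other corners have weights `|A| − K + 1 > |A|/2` twice and `K − 2`, i.e. normalised
weights `K − 1, K − 1, K − 2`: `faceVec_apply_of_wt`, `faceVec_apply_add_one_of_wt`) and renormalise; DESCENT (`descent`,
**`exists_reduced`**): every exponent vector is, modulo `pairs ⊔ spanFaces squares`, supported on the labels of weight `≤ 1` (the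
curve `E` = the label `0` and the single-defect factor `B₁` = the labels `δ s`, up to conjugation).  §3 KEY LEMMA
(**`eq_smul_weil_of_wt_le_one`**): a Hodge vector supported on the labels of weight `≤ 1` is a multiple of
`weil = Σ_s e_{δ s} − (|A| − 2)·e_0` (the Weil class of `E^{|A|−2} × B₁` of b17's parity-law file, in this labelling), because the
form of `(0,t)` on it reads `r_0 + Σ_s r_{δ s} − 2 r_{δ t} = 0` for every `t`.  Part IV finishes with the class functional and the
closing face.  All [folklore].

## References
* [Pohlmann1968] H. Pohlmann, Algebraic cycles on abelian varieties of complex multiplication type, Ann. of Math. 88 (1968), Thm 1.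
* [Milne1999] J. S. Milne, Lefschetz motives and the Tate conjecture, Compositio Math. 117 (1999), Prop. 2.1, p. 54.
-/

namespace Summit.HodgeConjecture.CorCM.Census.OddSliceFacesDescent

open Finset
open Summit.HodgeConjecture.CorCM.Census.OddSliceFacesModel
open Summit.HodgeConjecture.CorCM.Census.OddSliceFacesSquares

variable (A : Type) [AddCommGroup A] [Fintype A] [DecidableEq A]

/-! ## §1 The canonical squares and spans of face translates -/

/-- Two distinct defects of a type of weight `≥ 2` (a choice; junk `(0,0)` otherwise). [folklore] -/
noncomputable def pick (ψ : Ty A) : A × A :=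
  if h : 2 ≤ wt A ψ then ((exists_two_defects A h).choose, (exists_two_defects A h).choose_spec.choose) else (0, 0)

omit [DecidableEq A] in
/-- The chosen defects are distinct defects. [folklore] -/
theorem pick_spec {ψ : Ty A} (h : 2 ≤ wt A ψ) :
    (pick A ψ).1 ≠ (pick A ψ).2 ∧ ψ (pick A ψ).1 = 1 ∧ ψ (pick A ψ).2 = 1 := by
  unfold pick
  rw [dif_pos h]
  exact (exists_two_defects A h).choose_spec.choose_spec

/-- **The canonical square** of a simple factor: the face `(rep ω; i, j)` through two defects of its representative. [folklore] -/
noncomputable def sqFace (ω : OddDegreeParityLaw.OrbitsA A) : Ty A × A × A :=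
  (rep A ω, (pick A (rep A ω)).1, (pick A (rep A ω)).2)

/-- The canonical squares: one face per simple factor of defect class `≥ 2`. [folklore] -/
noncomputable def squares : Finset (Ty A × A × A) :=
  (univ.filter fun ω : OddDegreeParityLaw.OrbitsA A => 2 ≤ cls A ω).image (sqFace A)

/-- The span of all Galois translates of the classes of a family of faces. [folklore] -/
def spanFaces (S : Finset (Ty A × A × A)) : Submodule ℤ (Ty A → ℤ) :=
  Submodule.span ℤ {v | ∃ g : ZMod 2 × A, ∃ f ∈ S, v = transl A g (faceVec A f.1 f.2.1 f.2.2)}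

/-- `spanFaces` is monotone. [folklore] -/
theorem spanFaces_mono {S T : Finset (Ty A × A × A)} (h : S ⊆ T) : spanFaces A S ≤ spanFaces A T := by
  refine Submodule.span_mono ?_
  rintro v ⟨g, f, hf, rfl⟩
  exact ⟨g, f, h hf, rfl⟩

/-- `spanFaces S ≤ H` when all faces in `S` have distinct places. [folklore] -/
theorem spanFaces_le_hodge {S : Finset (Ty A × A × A)} (h : ∀ f ∈ S, f.2.1 ≠ f.2.2) : spanFaces A S ≤ hodge A := by
  refine Submodule.span_le.mpr ?_
  rintro v ⟨g, f, hf, rfl⟩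
  exact transl_mem A (faceVec_mem A f.1 (h f hf)) g

/-- The canonical squares have distinct places. [folklore] -/
theorem squares_places {f : Ty A × A × A} (hf : f ∈ squares A) : f.2.1 ≠ f.2.2 := by
  obtain ⟨ω, hω, rfl⟩ := Finset.mem_image.mp hf
  have h2 : 2 ≤ wt A (rep A ω) := by rw [wt_rep]; exact (Finset.mem_filter.mp hω).2
  exact (pick_spec A h2).1

/-- **Every normalised type of weight `K ≥ 2` is the main corner of a translated canonical square**: some element of
`spanFaces squares` is the class of a face `(ψ; i, j)` through two defects of `ψ`. [folklore] -/
theorem exists_square_through (hA : Odd (Fintype.card A)) {ψ : Ty A} (h2 : 2 ≤ wt A ψ) (hn : wt A ψ ≤ Fintype.card A / 2) :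
    ∃ v ∈ spanFaces A (squares A), ∃ i j : A, i ≠ j ∧ ψ i = 1 ∧ ψ j = 1 ∧ v = faceVec A ψ i j := by
  have hlt : wt A ψ < Fintype.card A := by have hodd2 : Fintype.card A % 2 = 1 := Nat.odd_iff.mp hA; omega
  have hnc : ¬ ∀ y, ψ y = ψ 0 := nonconst_of_wt A (by omega) hlt
  set ω : OddDegreeParityLaw.OrbitsA A := Quotient.mk _ (⟨ψ, hnc⟩ : OddDegreeParityLaw.Nonconst A) with hω
  have hcls : cls A ω = wt A ψ := by
    rw [hω, cls_mk]
    show min (wt A ψ) (Fintype.card A - wt A ψ) = wt A ψ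
    omega
  obtain ⟨t, ht⟩ := exists_tw_rep A hA ⟨ψ, hnc⟩ hn
  have ht' : tw A (0, t) (rep A ω) = ψ := ht
  have hrep2 : 2 ≤ wt A (rep A ω) := by rw [wt_rep, hcls]; exact h2
  obtain ⟨hij, hi, hj⟩ := pick_spec A hrep2
  set i₀ := (pick A (rep A ω)).1
  set j₀ := (pick A (rep A ω)).2
  refine ⟨transl A (0, t) (faceVec A (rep A ω) i₀ j₀), ?_, i₀ - t, j₀ - t, ?_, ?_, ?_, ?_⟩
  · refine Submodule.subset_span ⟨(0, t), sqFace A ω, ?_, rfl⟩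
    exact Finset.mem_image.mpr ⟨ω, Finset.mem_filter.mpr ⟨Finset.mem_univ _, by rw [hcls]; exact h2⟩, rfl⟩
  · exact fun h => hij (sub_left_injective h)
  · rw [← ht']; simp only [tw, sub_add_cancel, add_zero]; exact hi
  · rw [← ht']; simp only [tw, sub_add_cancel, add_zero]; exact hj
  · rw [transl_faceVec, ht']

/-! ## §2 Clearing by defect class and the descent -/

omit [AddCommGroup A] in
/-- Values of a face class. [folklore] -/
theorem faceVec_apply (φ : Ty A) (i j : A) (χ : Ty A) :
    faceVec A φ i j χ = (if χ = φ then 1 else 0) + (if χ = φ + 1 + δ A i then 1 else 0) +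
      (if χ = φ + 1 + δ A j then 1 else 0) + (if χ = φ + δ A i + δ A j then 1 else 0) := by
  simp only [faceVec, Pi.add_apply, Pi.single_apply]

omit [AddCommGroup A] in
/-- A face class through two defects of a normalised `φ` of weight `K` vanishes at every label of weight in `[K, |A|/2]` other
than `φ`, and at `φ` it is `1`. [folklore] -/
theorem faceVec_apply_of_wt (hA : Odd (Fintype.card A)) {φ : Ty A} {i j : A} (hi : φ i = 1) (hj : φ j = 1) (hij : i ≠ j)
    (hφ : wt A φ ≤ Fintype.card A / 2) (χ : Ty A) (hχ : wt A φ ≤ wt A χ) (hχ' : wt A χ ≤ Fintype.card A / 2) :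
    faceVec A φ i j χ = if χ = φ then 1 else 0 := by
  have hodd : Fintype.card A % 2 = 1 := Nat.odd_iff.mp hA
  have hwφ := wt_le A φ
  have h2φ : 2 ≤ wt A φ := by
    unfold wt
    exact Finset.one_lt_card_iff.mpr ⟨i, j, by simp [hi], by simp [hj], hij⟩
  rw [faceVec_apply]
  have h2 : χ ≠ φ + 1 + δ A i := by
    intro h; have := congrArg (wt A) h; rw [wt_corner_bar A hi] at this; omega
  have h3 : χ ≠ φ + 1 + δ A j := by
    intro h; have := congrArg (wt A) h; rw [wt_corner_bar A hj] at this; omega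
  have h4 : χ ≠ φ + δ A i + δ A j := by
    intro h; have := congrArg (wt A) h; rw [wt_corner_flip A hi hj hij] at this
    omega
  rw [if_neg h2, if_neg h3, if_neg h4, add_zero, add_zero, add_zero]

omit [AddCommGroup A] in
/-- The same face class vanishes at the conjugate `χ + 1` of every normalised label of weight `≥ K`. [folklore] -/
theorem faceVec_apply_add_one_of_wt (hA : Odd (Fintype.card A)) {φ : Ty A} {i j : A} (hi : φ i = 1) (hj : φ j = 1) (hij : i ≠ j)
    (hφ : wt A φ ≤ Fintype.card A / 2) (χ : Ty A) (hχ : wt A φ ≤ wt A χ) (hχ' : wt A χ ≤ Fintype.card A / 2) :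
    faceVec A φ i j (χ + 1) = 0 := by
  have hodd : Fintype.card A % 2 = 1 := Nat.odd_iff.mp hA
  have hwφ := wt_le A φ
  have hwχ := wt_le A χ
  have h2φ : 2 ≤ wt A φ := by
    unfold wt
    exact Finset.one_lt_card_iff.mpr ⟨i, j, by simp [hi], by simp [hj], hij⟩
  have hw1 : wt A (χ + 1) = Fintype.card A - wt A χ := wt_add_one A χ
  rw [faceVec_apply]
  have h1 : χ + 1 ≠ φ := by
    intro h; have := congrArg (wt A) h; omega
  have h2 : χ + 1 ≠ φ + 1 + δ A i := by
    intro h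
    have h' : χ = φ + 1 + δ A i + 1 := by rw [← h, add_one_add_one]
    have := congrArg (wt A) h'; rw [wt_corner_bar_add_one A hi] at this; omega
  have h3 : χ + 1 ≠ φ + 1 + δ A j := by
    intro h
    have h' : χ = φ + 1 + δ A j + 1 := by rw [← h, add_one_add_one]
    have := congrArg (wt A) h'; rw [wt_corner_bar_add_one A hj] at this; omega
  have h4 : χ + 1 ≠ φ + δ A i + δ A j := by
    intro h; have := congrArg (wt A) h; rw [wt_corner_flip A hi hj hij] at this; omega
  rw [if_neg h1, if_neg h2, if_neg h3, if_neg h4, add_zero, add_zero, add_zero]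

/-- **Clearing step.**  A vector supported in weight `≤ K`, `2 ≤ K ≤ |A|/2`, is congruent modulo `pairs ⊔ spanFaces squares` to a
vector supported in weight `≤ K − 1`. [folklore] -/
theorem clear_step (hA : Odd (Fintype.card A)) {K : ℕ} (hK2 : 2 ≤ K) (hKp : K ≤ Fintype.card A / 2) (m : Ty A → ℤ)
    (hm : ∀ χ, m χ ≠ 0 → wt A χ ≤ K) :
    ∃ m' : Ty A → ℤ, (∀ χ, m' χ ≠ 0 → wt A χ ≤ K - 1) ∧ m - m' ∈ pairs A ⊔ spanFaces A (squares A) := by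
  have hodd : Fintype.card A % 2 = 1 := Nat.odd_iff.mp hA
  -- one translated canonical square through each label of weight `K`
  have hF : ∀ ψ : Ty A, wt A ψ = K → ∃ v : Ty A → ℤ, v ∈ spanFaces A (squares A) ∧
      ∃ i j : A, i ≠ j ∧ ψ i = 1 ∧ ψ j = 1 ∧ v = faceVec A ψ i j := by
    intro ψ hψ
    obtain ⟨v, hv, i, j, hij, hi, hj, rfl⟩ := exists_square_through A hA (ψ := ψ) (by omega) (by omega)
    exact ⟨_, hv, i, j, hij, hi, hj, rfl⟩
  choose! F hFmem ci cj hcij hci hcj hFeq using hF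
  set L : Finset (Ty A) := univ.filter fun ψ => wt A ψ = K with hL
  set q : Ty A → ℤ := ∑ ψ ∈ L, m ψ • F ψ with hq
  have hqmem : q ∈ spanFaces A (squares A) :=
    Submodule.sum_mem _ fun ψ hψ => Submodule.smul_mem _ _ (hFmem ψ (Finset.mem_filter.mp hψ).2)
  -- values of `q`
  have hqval : ∀ χ : Ty A, K ≤ wt A χ → wt A χ ≤ Fintype.card A / 2 → q χ = if wt A χ = K then m χ else 0 := by
    intro χ hχ hχ'
    rw [hq, Finset.sum_apply]
    have hterm : ∀ ψ ∈ L, (m ψ • F ψ) χ = if χ = ψ then m ψ else 0 := by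
      intro ψ hψ
      have hψK : wt A ψ = K := (Finset.mem_filter.mp hψ).2
      rw [Pi.smul_apply, smul_eq_mul, hFeq ψ hψK,
        faceVec_apply_of_wt A hA (hci ψ hψK) (hcj ψ hψK) (hcij ψ hψK) (by omega) χ (by omega) hχ']
      split_ifs <;> ring
    rw [Finset.sum_congr rfl hterm, Finset.sum_ite_eq]
    have hLmem : χ ∈ L ↔ wt A χ = K := by rw [hL]; simp
    by_cases hχK : wt A χ = K
    · rw [if_pos (hLmem.mpr hχK), if_pos hχK]
    · rw [if_neg (fun h => hχK (hLmem.mp h)), if_neg hχK]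
  have hqval' : ∀ χ : Ty A, K ≤ wt A χ → wt A χ ≤ Fintype.card A / 2 → q (χ + 1) = 0 := by
    intro χ hχ hχ'
    rw [hq, Finset.sum_apply]
    refine Finset.sum_eq_zero fun ψ hψ => ?_
    have hψK : wt A ψ = K := (Finset.mem_filter.mp hψ).2
    rw [Pi.smul_apply, smul_eq_mul, hFeq ψ hψK,
      faceVec_apply_add_one_of_wt A hA (hci ψ hψK) (hcj ψ hψK) (hcij ψ hψK) (by omega) χ (by omega) hχ', mul_zero]
  refine ⟨nrm A (m - q), ?_, ?_⟩
  · intro χ hχ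
    have hn : wt A χ ≤ Fintype.card A / 2 := wt_le_of_nrm_ne_zero A _ hχ
    by_contra hK
    apply hχ
    have hKle : K ≤ wt A χ := by omega
    simp only [nrm, if_pos hn, Pi.sub_apply]
    rw [hqval χ hKle hn, hqval' χ hKle hn]
    have hm1 : m (χ + 1) = 0 := by
      by_contra h
      have := hm _ h
      rw [wt_add_one] at this
      omega
    rw [hm1]
    by_cases hχK : wt A χ = K
    · rw [if_pos hχK]; ring
    · rw [if_neg hχK]
      have hm0 : m χ = 0 := by
        by_contra h; exact hχK (le_antisymm (hm _ h) hKle)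
      rw [hm0]; ring
  · have : m - nrm A (m - q) = (m - q - nrm A (m - q)) + q := by abel
    rw [this]
    exact Submodule.add_mem _ (Submodule.mem_sup_left (sub_nrm_mem_pairs A hA _)) (Submodule.mem_sup_right hqmem)

/-- **Descent.**  A vector supported in weight `≤ K ≤ |A|/2` is congruent modulo `pairs ⊔ spanFaces squares` to a vector supported
in weight `≤ 1`. [folklore] -/
theorem descent (hA : Odd (Fintype.card A)) (K : ℕ) (hKp : K ≤ Fintype.card A / 2) (m : Ty A → ℤ) (hm : ∀ χ, m χ ≠ 0 → wt A χ ≤ K) :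
    ∃ r : Ty A → ℤ, (∀ χ, r χ ≠ 0 → wt A χ ≤ 1) ∧ m - r ∈ pairs A ⊔ spanFaces A (squares A) := by
  induction K generalizing m with
  | zero => exact ⟨m, fun χ h => (hm χ h).trans (Nat.zero_le 1), by rw [sub_self]; exact Submodule.zero_mem _⟩
  | succ K ih =>
    by_cases hK1 : K + 1 ≤ 1
    · exact ⟨m, fun χ h => (hm χ h).trans hK1, by rw [sub_self]; exact Submodule.zero_mem _⟩
    · obtain ⟨m', hm', hdiff⟩ := clear_step A hA (K := K + 1) (by omega) hKp m hm
      obtain ⟨r, hr, hdiff'⟩ := ih (by omega) m' (fun χ h => by have := hm' χ h; omega)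
      refine ⟨r, hr, ?_⟩
      have : m - r = (m - m') + (m' - r) := by abel
      rw [this]
      exact Submodule.add_mem _ hdiff hdiff'

/-- **Every exponent vector is, modulo pairs and translates of canonical squares, supported on the labels of weight `≤ 1`**
(the curve `E` and, for `|A| > 1`, the single-defect factor `B₁`). [folklore] -/
theorem exists_reduced (hA : Odd (Fintype.card A)) (m : Ty A → ℤ) :
    ∃ r : Ty A → ℤ, (∀ χ, r χ ≠ 0 → wt A χ ≤ 1) ∧ m - r ∈ pairs A ⊔ spanFaces A (squares A) := by
  obtain ⟨r, hr, hdiff⟩ := descent A hA (Fintype.card A / 2) le_rfl (nrm A m) (fun χ h => wt_le_of_nrm_ne_zero A m h)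
  refine ⟨r, hr, ?_⟩
  have : m - r = (m - nrm A m) + (nrm A m - r) := by abel
  rw [this]
  exact Submodule.add_mem _ (Submodule.mem_sup_left (sub_nrm_mem_pairs A hA m)) hdiff

/-! ## §3 The key lemma: Hodge vectors supported on `E ∪ B₁` are multiples of the Weil vector -/

omit [AddCommGroup A] [Fintype A] in
/-- Values of `δ`: `δ s ≠ 0`. [folklore] -/
theorem delta_ne_zero (s : A) : δ A s ≠ (0 : Ty A) := by
  intro h
  have := congrFun h s
  rw [delta_apply, if_pos rfl, Pi.zero_apply] at this
  exact absurd this (by decide)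

omit [AddCommGroup A] [Fintype A] in
/-- `δ` is injective. [folklore] -/
theorem delta_inj {s s' : A} (h : δ A s = δ A s') : s = s' := by
  by_contra hne
  have := congrFun h s
  rw [delta_apply, delta_apply, if_pos rfl, if_neg hne] at this
  exact absurd this (by decide)

omit [AddCommGroup A] [DecidableEq A] in
/-- Weight of `0` and of `δ s`. [folklore] -/
theorem wt_zero : wt A (0 : Ty A) = 0 := by
  unfold wt
  rw [Finset.card_eq_zero]
  ext s; simp

omit [AddCommGroup A] in
/-- Weight of `δ s` is `1`. [folklore] -/
theorem wt_delta (s : A) : wt A (δ A s) = 1 := by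
  have h : δ A s = ind A {s} := by funext s'; simp [ind, delta_apply]
  rw [h, wt_ind, Finset.card_singleton]

/-- The Weil vector of `E^{|A|−2} × B₁` in the representative-free labelling: `Σ_s e_{δ s} − (|A| − 2)·e_0`. [folklore] -/
def weil : Ty A → ℤ := ∑ s : A, Pi.single (δ A s) 1 - ((Fintype.card A : ℤ) - 2) • Pi.single (0 : Ty A) 1

omit [AddCommGroup A] in
/-- The form of `(0,t)` on `Σ_s c_s e_{δ s}`: `Σ_s c_s − 2 c_t`. [folklore] -/
theorem coef_zero_dotProduct_sum_delta (t : A) (c : A → ℤ) :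
    coef A (0, t) ⬝ᵥ (∑ s : A, c s • Pi.single (δ A s) (1 : ℤ)) = (∑ s : A, c s) - 2 * c t := by
  rw [dotProduct_sum]
  have hterm : ∀ s : A, coef A (0, t) ⬝ᵥ (c s • Pi.single (δ A s) (1 : ℤ)) = c s - 2 * (if t = s then c s else 0) := by
    intro s
    rw [dotProduct_smul, coef_zero_dotProduct_single, mul_one, smul_eq_mul, delta_apply]
    by_cases hts : t = s
    · rw [if_pos hts, if_pos hts, if_neg (by decide)]; ring
    · rw [if_neg hts, if_neg hts, if_pos rfl]; ring
  simp_rw [hterm]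
  rw [Finset.sum_sub_distrib, ← Finset.mul_sum, Finset.sum_ite_eq, if_pos (Finset.mem_univ _)]

omit [AddCommGroup A] in
/-- The form of `(0,t)` on `c • e_0` is `c`. [folklore] -/
theorem coef_zero_dotProduct_single_zero (t : A) (c : ℤ) :
    coef A (0, t) ⬝ᵥ (c • Pi.single (0 : Ty A) (1 : ℤ)) = c := by
  rw [dotProduct_smul, coef_zero_dotProduct_single, smul_eq_mul]
  simp

/-- **Key lemma.**  A Hodge vector supported on the labels of weight `≤ 1` is `r(δ 0) • weil`. [folklore] -/
theorem eq_smul_weil_of_wt_le_one (r : Ty A → ℤ) (hr : r ∈ hodge A) (hsupp : ∀ χ, r χ ≠ 0 → wt A χ ≤ 1) :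
    r = r (δ A 0) • weil A := by
  -- (a) explicit form of `r`
  set R : Ty A → ℤ := ∑ s : A, r (δ A s) • Pi.single (δ A s) 1 + r 0 • Pi.single (0 : Ty A) 1 with hR
  have hRval : ∀ χ : Ty A, R χ = (if ∃ s, χ = δ A s then r χ else 0) + (if χ = 0 then r χ else 0) := by
    intro χ
    rw [hR, Pi.add_apply, Finset.sum_apply, Pi.smul_apply, smul_eq_mul, Pi.single_apply]
    simp only [Pi.smul_apply, smul_eq_mul, Pi.single_apply]
    congr 1
    · by_cases h : ∃ s, χ = δ A s
      · obtain ⟨s, rfl⟩ := h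
        rw [if_pos ⟨s, rfl⟩]
        have : ∀ s' : A, r (δ A s') * (if δ A s = δ A s' then (1 : ℤ) else 0) = if s = s' then r (δ A s') else 0 := by
          intro s'
          by_cases hss : s = s'
          · subst hss; simp
          · rw [if_neg (fun h => hss (delta_inj A h)), if_neg hss, mul_zero]
        rw [Finset.sum_congr rfl fun s' _ => this s', Finset.sum_ite_eq, if_pos (Finset.mem_univ _)]
      · rw [if_neg h]
        refine Finset.sum_eq_zero fun s' _ => ?_
        rw [if_neg (fun hh => h ⟨s', hh⟩), mul_zero]
    · by_cases h : χ = 0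
      · subst h; simp
      · rw [if_neg h, if_neg h, mul_zero]
  have hrR : r = R := by
    funext χ
    rw [hRval]
    by_cases h1 : ∃ s, χ = δ A s
    · obtain ⟨s, rfl⟩ := h1
      rw [if_pos ⟨s, rfl⟩, if_neg (delta_ne_zero A s), add_zero]
    · by_cases h0 : χ = 0
      · subst h0; rw [if_neg h1, if_pos rfl, zero_add]
      · rw [if_neg h1, if_neg h0, add_zero]
        by_contra hne
        rcases eq_zero_or_eq_delta_of_wt_le_one A (hsupp χ hne) with h | ⟨s, hs⟩
        · exact h0 h
        · exact h1 ⟨s, hs⟩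
  -- (b) the forms of `(0,t)` on `R`
  have hform : ∀ t : A, coef A (0, t) ⬝ᵥ R = (∑ s : A, r (δ A s)) - 2 * r (δ A t) + r 0 := by
    intro t
    rw [hR, dotProduct_add, coef_zero_dotProduct_sum_delta, coef_zero_dotProduct_single_zero]
  have hzero : ∀ t : A, coef A (0, t) ⬝ᵥ R = 0 := by
    intro t; rw [← hrR]; exact hr (0, t)
  -- (c) the coefficients on `B₁` are constant
  have hconst : ∀ s : A, r (δ A s) = r (δ A 0) := by
    intro s
    have h1 := hzero s
    have h2 := hzero 0
    rw [hform] at h1 h2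
    linarith
  -- (d) the `E`-coefficient
  have hE : r 0 = -(((Fintype.card A : ℤ) - 2) * r (δ A 0)) := by
    have h2 := hzero 0
    rw [hform, Finset.sum_congr rfl fun s _ => hconst s, Finset.sum_const, Finset.card_univ, nsmul_eq_mul] at h2
    linarith
  -- (e) assemble
  have hRw : R = r (δ A 0) • weil A := by
    rw [hR, weil, smul_sub, Finset.smul_sum, smul_smul, Finset.sum_congr rfl fun s _ => by rw [hconst s], hE]
    have hc : r (δ A 0) * ((Fintype.card A : ℤ) - 2) = ((Fintype.card A : ℤ) - 2) * r (δ A 0) := mul_comm _ _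
    rw [hc, neg_smul, ← sub_eq_add_neg]
  exact hrR.trans hRw

end Summit.HodgeConjecture.CorCM.Census.OddSliceFacesDescent
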